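import Summits.BirchSwinnertonDyer.Rank1Residual.ManinAdditive.DegeneracyOrbitCriterion
import HarnessLib
import HarnessLib.Audit.Tags

/-!
# The CONJUGATION-DEFECT law (CD₉) `ConjDefectLawNine` and the MOD-3 SPAN law (H₉ mod 3) `ClassLoopSpanLawNineMod3`, with their
# PROVED edges to E-es-66|squarefull and `3 ∤ c(W)` — typed (es g22/g23, MEMO-es §36.16/§37; cell `bsd-f2-manin`, T-es-30 file 2/2, part B, typer g15)

HONEST FRAMING.  Continuation of `DegeneracyOrbitCriterion.lean` (same source HOME/es/Sketch-es-g23-orbit.lean sha16 5ff425108273d8d9, sections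
`Packaging` (law part) and `SpanLawMod3` VERBATIM, namespace `…ManinAdditive.DegeneracyOrbit`), except: (i) this header; (ii) the two laws carry
`@[conjecture]` (obligation nodes, nothing asserted) with a typer framing line.
THE TWO LAWS (es, not the tree).  **(CD₉) `ConjDefectLawNine`** (es g22 candidate): for a rational newform `f` of level `N`, `9 ∣ N`, with
`[Λ_f⁺ : Λ_{Γ₁,f}⁺]` prime to 3, the plus-period homomorphism mod 3 is not `diag(9,1)`-conjugation invariant on `Γ₀(9N)` — by the ORBIT
CRITERION exactly the plus form of (K₉)♮ (tree E-es-91 `DegeneracyClassLoopLawNine` ⟹ (CD₉): `conjDefectLawNine_of_classLawNine`, PROVED).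
**(H₉ mod 3) `ClassLoopSpanLawNineMod3`** (the WEAKEST law of the chain; CANDIDATES row with E-es-94/94♯): at `9 ∣ N`, every `Γ₁(N)`-period of a
weight-2 cusp form is a sum of prime-class ratio-9 loops modulo `3·Λ_f` — E-es-91 read mod `3Λ_f` (`spanLawMod3_of_classLawNine`, PROVED), no
newform/rationality hypothesis; BC5: ENGINE 3′ (Manin symbols mod 3, f-free) `span_𝔽₃{ {r, 9r} } = image(H₁(X₁(N);𝔽₃) → H₁(X₀(N);𝔽₃))` at 29/29
levels `N ∈ 9ℕ ∩ [18, 270]` (HOME/es/g22/ENGINE3-INV-CENSUS-v1.txt), v2 39/39 to 360 (a3d3b762cdde7e12), second engine ENGINE 4 (g23) 0 violations /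
124 levels; its f-free parent E-es-94♯ `NineShiftInvariantIsDiamond` is typed in `NineShiftEqualiserLaw.lean` (the bridge E-es-94 ⟹ (H₉ mod 3) is
PAPER, MEMO-es §37: Manin presentation + duality over `𝔽₃`).  PROVED EDGES (es g22): `degeneracyClass_of_spanLawMod3` ((H₉ mod 3) +
`PlusIndexPrimeTo 3 f` ⟹ `DegeneracyClassPlusIndexPrimeTo f 3 9` at every rational newform), `conjDefectLawNine_of_spanLawMod3`, and through the
tree's `threeAdicPolarWitness_of_degeneracyClassNine` / `not_three_dvd_maninConstant_of_degeneracyClassNine`: **E-es-66|squarefull** and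
**`3 ∤ c(W)`** at composite squarefull levels from (CD₉) resp. (H₉ mod 3) (+ Kato at 3, additivity of `W` at 3 as binders).
REFUTER VERDICTS: BC7 3/3 CLEAN per es (with E-es-94/94♯); R-es-45 (ref1 audit + BC7-by-name) PENDING at filing.  bears_on:
stmt-BirchSwinnertonDyer-22968.  PARTITION (es) 0 · beyond-print theorem: no · BSD is not proved by this; Manin's conjecture is not proved by this.
-/

noncomputable section

open scoped Classical MatrixGroups ModularForm ComplexConjugate

open CongruenceSubgroup Complex Literature.NumberTheory.EllipticCurves
  Literature.NumberTheory.EllipticCurves.ModularForms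
open Summit.BirchSwinnertonDyer.Rank1Residual.ManinAdditive.KatoCurve
open Summit.BirchSwinnertonDyer.Rank1Residual.ManinAdditive.Gamma1Lattice

namespace Summit.BirchSwinnertonDyer.Rank1Residual.ManinAdditive.DegeneracyOrbit

variable {N : ℕ} (f : CuspForm (Gamma0 N) 2)

section ConjDefectLaw

variable [NeZero N]

/-- **LAW (CD₉) — the CONJUGATION-DEFECT form of (K₉)♮ (es g22 candidate; obligation node, nothing asserted).**
For a rational newform `f` of level `N`, `9 ∣ N`, with `[Λ_f⁺ : Λ_{Γ₁,f}⁺]` prime to `3`, the plus-period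
homomorphism mod `3` is not `diag(9,1)`-conjugation invariant on `Γ₀(9N)`.  By the ORBIT CRITERION this is
EXACTLY the plus form of (K₉)♮ consumed by the W-level theorems (`threeAdicPolarWitness_of_degeneracyClassNine`).
TYPER FRAMING ((CD₉), es g22): lens es; LAW (obligation node), nothing asserted. [conjecture — cell candidate, NOT a tree fact] -/
@[conjecture] def ConjDefectLawNine : Prop :=
  ∀ {N : ℕ} [NeZero N], 3 ^ 2 ∣ N → ∀ f : CuspForm (Gamma0 N) 2, IsNewform0 f → coeffField f = ⊥ →
    PlusIndexPrimeTo 3 f → ConjDefectUnit f 9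

/-- (K₉)♮ (tree E-es-91, lattice form) ⟹ (CD₉) (PROVED). -/
theorem conjDefectLawNine_of_classLawNine (h : DegeneracyClassLoopLawNine) : ConjDefectLawNine := by
  intro N _ h9 f hf hQ hplus
  exact conjDefect_of_degeneracyClass f hf hQ (degeneracyClassPlusIndexPrimeTo_of_lawNine f h h9 hplus)

open WeierstrassCurve in
/-- **E-es-66|squarefull ⟸ (CD₉) (es g22; PROVED).**  The es-side open input of C3 (`ThreeAdicWitnessOfPlusIndexPrimeToThree`,
additivity of `W` at `3` as binders) at SQUAREFULL levels follows from the conjugation-defect law alone. -/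
theorem threeAdicPolarWitness_of_conjDefectLawNine_squarefull (hlaw : ConjDefectLawNine)
    (W : WeierstrassCurve ℚ) [W.IsElliptic] {N : ℕ} [NeZero N] (D : ModularParametrizationData W N)
    (h3g : ¬ W.HasGoodReductionAtPrime 3) (h3m : ¬ W.HasMultiplicativeReductionAtPrime 3)
    (h9 : 3 ^ 2 ∣ N) (hsq : IsSquarefull N) (hd : PlusIndexPrimeTo 3 D.f) :
    ThreeAdicPolarWitness W W D.f :=
  threeAdicPolarWitness_of_degeneracyClassNine W D h3g h3m hsq
    ((degeneracyClass_iff_conjDefectUnit D.f D.isNewformOf.1 D.isNewformOf.coeffField_eq_bot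
        (by norm_num) ⟨3, by norm_num⟩).mpr
      (hlaw h9 D.f D.isNewformOf.1 D.isNewformOf.coeffField_eq_bot hd))

open WeierstrassCurve in
/-- **3 ∤ c(W) ⟸ (CD₉) + Kato at 3 (es g22; PROVED)** at composite squarefull levels, via the tree corollary. -/
theorem not_three_dvd_maninConstant_of_conjDefectLawNine (hlaw : ConjDefectLawNine)
    (W : WeierstrassCurve ℚ) [W.IsElliptic] [W.IsGloballyMinimal] {N : ℕ} [NeZero N]
    (D : ModularParametrizationData W N) (hF : KatoFactThreeAt W D.f)
    (hopt : ∀ z ∈ D.L.lattice, ∃ w ∈ periodLattice D.f, z = D.c * w)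
    (h3g : ¬ W.HasGoodReductionAtPrime 3) (h3m : ¬ W.HasMultiplicativeReductionAtPrime 3)
    (h9 : 3 ^ 2 ∣ N) (hsq : IsSquarefull N) (hd : PlusIndexPrimeTo 3 D.f) : ¬ (3 : ℤ) ∣ D.c :=
  not_three_dvd_maninConstant_of_degeneracyClassNine W D hF hopt h3g h3m hsq
    ((degeneracyClass_iff_conjDefectUnit D.f D.isNewformOf.1 D.isNewformOf.coeffField_eq_bot
        (by norm_num) ⟨3, by norm_num⟩).mpr
      (hlaw h9 D.f D.isNewformOf.1 D.isNewformOf.coeffField_eq_bot hd))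

end ConjDefectLaw

section SpanLawMod3

/-- **LAW (H₉ mod 3) — the MOD-3 SPAN form of (K₉)♮ (es g22 candidate; the WEAKEST law of the chain; an
obligation node, nothing asserted).**  At level `9 ∣ N`, every `Γ₁(N)`-period of a weight-2 cusp form `f` is a
sum of prime-class ratio-9 loops `{b/m → 9b/m}` (`m` prime, `m ≡ 2 (mod 3)`) modulo `3·Λ_f`:
`Λ_{Γ₁}(f) ⊆ closure(degeneracyLoopsClassTwo f 9) + 3·Λ_f`.  It is E-es-91 `DegeneracyClassLoopLawNine` read
modulo `3Λ_f` (only the inclusion `⊇` of the lattice law, and only mod 3), it needs no newform / rationality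
hypothesis, and it is the HOMOLOGICAL statement certified by ENGINE 3′ (pure Manin symbols mod 3, f-free):
`span_𝔽₃{ {r, 9r} : den(r) prime to 3N } = image(H₁(X₁(N);𝔽₃) → H₁(X₀(N);𝔽₃))` at all 29 levels
`N ∈ 9ℕ ∩ [18, 270]` (HOME/es/g22/ENGINE3-INV-CENSUS-v1.txt; equality, 0 exceptions; by the orbit/cocycle identity
the 𝔽₃-span of all such loops equals the span of the prime-class ones).  g23 (MEMO-es §37): second engine ENGINE 4
(transfer equaliser, disjoint code path) 0 violations / 124 levels; f-free parent law E-es-94♯ in `NineShiftEqualiserLaw.lean`.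
TYPER FRAMING ((H₉ mod 3), CANDIDATES row with E-es-94/94♯): lens es; LAW (obligation node), nothing asserted. [conjecture — cell candidate, NOT a tree fact] -/
@[conjecture] def ClassLoopSpanLawNineMod3 : Prop :=
  ∀ {N : ℕ} [NeZero N], 3 ^ 2 ∣ N → ∀ f : CuspForm (Gamma0 N) 2, ∀ y ∈ periodLatticeGamma1 f,
    ∃ ℓ ∈ AddSubgroup.closure (degeneracyLoopsClassTwo f 9), ∃ z ∈ periodLattice f, y = ℓ + 3 * z

/-- E-es-91 (lattice equality) ⟹ (H₉ mod 3) (PROVED; take `z = 0`). -/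
theorem spanLawMod3_of_classLawNine (h : DegeneracyClassLoopLawNine) : ClassLoopSpanLawNineMod3 := by
  intro N _ h9 f y hy
  refine ⟨y, ?_, 0, zero_mem _, by ring⟩
  rw [h h9 f]
  exact hy

variable [NeZero N]

/-- **(H₉ mod 3) ⟹ the plus form of (K₉)♮ at every rational newform (es g22; PROVED).**
If `[Λ_f⁺ : Λ_{Γ₁,f}⁺]` is prime to `3` and `Λ_{Γ₁}(f) ⊆ closure(loops) + 3Λ_f`, then a unit multiple of every plus
coordinate is the plus coordinate of a sum of prime-class ratio-9 loops: pick `x₀` with `x₀ + x̄₀ = Ω`, a `Γ₁`-period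
`y₀` with `y₀⁺ = k₀Ω`, `3 ∤ k₀`, write `y₀ = ℓ₀ + 3z₀`; then `ℓ₀⁺ = (k₀ − 3n₀)Ω` is a unit coordinate and integer
multiples of `ℓ₀` serve every `x ∈ Λ_f`. -/
theorem degeneracyClass_of_spanLawMod3 (hlaw : ClassLoopSpanLawNineMod3) (h9 : 3 ^ 2 ∣ N)
    (hf : IsNewform0 f) (hQ : coeffField f = ⊥) (hd : PlusIndexPrimeTo 3 f) :
    DegeneracyClassPlusIndexPrimeTo f 3 9 := by
  have hΩpos : 0 < plusPeriod f := IsNewform0.plusPeriod_pos_holds hf hQ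
  have hΩ : plusPeriod f ≠ 0 := hΩpos.ne'
  obtain ⟨hre, -⟩ := realPeriods_eq_zmultiples_of_plusPeriod_ne_zero f hΩ
  obtain ⟨x₀, hx₀, hx₀tr⟩ := exists_mem_add_conj_eq f hre
  obtain ⟨y₀, hy₀, k₀, hk₀3, hk₀⟩ := hd x₀ hx₀
  obtain ⟨ℓ₀, hℓ₀, z₀, hz₀, hyz₀⟩ := hlaw h9 f y₀ hy₀
  obtain ⟨n₀, hn₀⟩ := exists_add_conj_eq_int_mul f hre hz₀
  set K : ℤ := (k₀ : ℤ) - 3 * n₀ with hK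
  have h1 : (k₀ : ℂ) * (x₀ + conj x₀) = y₀ + conj y₀ := hk₀
  rw [hx₀tr, hyz₀] at h1
  simp only [map_add, map_mul, map_ofNat] at h1
  have key : ℓ₀ + conj ℓ₀ = (K : ℂ) * (plusPeriod f : ℂ) := by
    rw [hK]; push_cast
    linear_combination -h1 - 3 * hn₀
  have hunit : ¬ (3 : ℤ) ∣ K := by
    rintro ⟨w, hw⟩
    refine hk₀3 (Int.natCast_dvd_natCast.mp ⟨w + n₀, ?_⟩)
    push_cast
    linear_combination hw
  have habs : ((K.natAbs : ℕ) : ℂ) = (K.sign : ℂ) * (K : ℂ) := by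
    have h : (K.sign * K : ℤ) = (K.natAbs : ℤ) := Int.sign_mul_self_eq_natAbs K
    calc ((K.natAbs : ℕ) : ℂ) = (((K.natAbs : ℕ) : ℤ) : ℂ) := (Int.cast_natCast K.natAbs).symm
      _ = ((K.sign * K : ℤ) : ℂ) := by rw [h]
      _ = (K.sign : ℂ) * (K : ℂ) := by push_cast; ring
  intro x hx
  obtain ⟨n, hn⟩ := exists_add_conj_eq_int_mul f hre hx
  refine ⟨(K.sign * n) • ℓ₀, AddSubgroup.zsmul_mem _ hℓ₀ _, K.natAbs, ?_, ?_⟩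
  · intro h3
    exact hunit (Int.ofNat_dvd_left.mpr h3)
  · have hconj : conj ((K.sign * n) • ℓ₀) = (K.sign * n) • conj ℓ₀ := map_zsmul _ _ _
    have hxn : x + conj x = (n : ℂ) * (plusPeriod f : ℂ) := hn
    show ((K.natAbs : ℕ) : ℂ) * (x + conj x) = (K.sign * n) • ℓ₀ + conj ((K.sign * n) • ℓ₀)
    rw [hconj, ← smul_add, key, hxn, habs, zsmul_eq_mul]
    push_cast
    ring

/-- (H₉ mod 3) ⟹ (CD₉) (PROVED). -/
theorem conjDefectLawNine_of_spanLawMod3 (h : ClassLoopSpanLawNineMod3) : ConjDefectLawNine := by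
  intro N _ h9 f hf hQ hplus
  exact conjDefect_of_degeneracyClass f hf hQ (degeneracyClass_of_spanLawMod3 f h h9 hf hQ hplus)

open WeierstrassCurve in
/-- **E-es-66|squarefull ⟸ (H₉ mod 3) (es g22; PROVED)** — the es-side open input of C3 at squarefull levels
from the weakest law of the chain. -/
theorem threeAdicPolarWitness_of_spanLawMod3_squarefull (hlaw : ClassLoopSpanLawNineMod3)
    (W : WeierstrassCurve ℚ) [W.IsElliptic] {N : ℕ} [NeZero N] (D : ModularParametrizationData W N)
    (h3g : ¬ W.HasGoodReductionAtPrime 3) (h3m : ¬ W.HasMultiplicativeReductionAtPrime 3)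
    (h9 : 3 ^ 2 ∣ N) (hsq : IsSquarefull N) (hd : PlusIndexPrimeTo 3 D.f) :
    ThreeAdicPolarWitness W W D.f :=
  threeAdicPolarWitness_of_degeneracyClassNine W D h3g h3m hsq
    (degeneracyClass_of_spanLawMod3 D.f hlaw h9 D.isNewformOf.1 D.isNewformOf.coeffField_eq_bot hd)

open WeierstrassCurve in
/-- **3 ∤ c(W) ⟸ (H₉ mod 3) + Kato at 3 (es g22; PROVED)** at composite squarefull levels. -/
theorem not_three_dvd_maninConstant_of_spanLawMod3 (hlaw : ClassLoopSpanLawNineMod3)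
    (W : WeierstrassCurve ℚ) [W.IsElliptic] [W.IsGloballyMinimal] {N : ℕ} [NeZero N]
    (D : ModularParametrizationData W N) (hF : KatoFactThreeAt W D.f)
    (hopt : ∀ z ∈ D.L.lattice, ∃ w ∈ periodLattice D.f, z = D.c * w)
    (h3g : ¬ W.HasGoodReductionAtPrime 3) (h3m : ¬ W.HasMultiplicativeReductionAtPrime 3)
    (h9 : 3 ^ 2 ∣ N) (hsq : IsSquarefull N) (hd : PlusIndexPrimeTo 3 D.f) : ¬ (3 : ℤ) ∣ D.c :=
  not_three_dvd_maninConstant_of_degeneracyClassNine W D hF hopt h3g h3m hsq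
    (degeneracyClass_of_spanLawMod3 D.f hlaw h9 D.isNewformOf.1 D.isNewformOf.coeffField_eq_bot hd)

end SpanLawMod3

end Summit.BirchSwinnertonDyer.Rank1Residual.ManinAdditive.DegeneracyOrbit

end
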